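/-
Copyright (c) 2026 the pub-hodgecm-mathlib formalisation cell (harness21).  Prover seat hodgecm-mathlib-K2E3-p06 (g5), Track B «K2-LIT», engine E3, unit U4 «Keys»; deal (D61)
LINE LEAD of the open leaf (U4f-χ₁-ram-one), design D-I, plan DESIGN-B v1 steps (B6)+(B7) «THE WEIGHT INTEGRALS AS TWO-STEP GEOMETRIC SHELL SERIES; THE BASE-SHELL EQUATION» on `N(L⁺_v)`;
2026-09-04.  KERNEL module: THEOREMS ONLY (no definition, no named fact, no `sorry`, no instance, no notation).
-/
import Summits.HodgeConjecture.HodgeConjecture.Theorems.K2E3WeightShellDilation              -- ★-filed (B5) (this seat): `setIntegral_weight_shell_succ_succ` (`T_{j+2} = χ₁(ασα) T_j`); brings the weight letters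
import Summits.HodgeConjecture.HodgeConjecture.Theorems.K2E3SphericalCFunctionClosedForm      -- ★ p856166 (K2E3-p04): `hasSum_of_succ_succ_eq_mul` (two-step geometric series), `shell_eq_ball_diff`; brings ★ `height_le_one_or_eq_inv_pow`, `unitModulusChar_uniformizer_lt_one`
import HarnessLib

/-!
# K2 ∕ E3 «EllipticInputs», unit U4 «Keys» — (U4f-χ₁-ram-one) steps (B6)+(B7) of DESIGN-B: THE WEIGHT INTEGRALS `G₁ = ∫_{m>1} c`, `G₂ = ∫_{m≥1} c` ARE TWO-STEP GEOMETRIC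
# SHELL SERIES — `G₁(1−ρ) = T_1 + ρT_0`, `G₂(1−ρ) = T_0 + T_1`, `ρ = χ₁(ϖσϖ)` — AND THE BASE-SHELL EQUATION `G₁G₂ = v_0v_{-1} ⟹ (T_1+ρT_0)(T_0+T_1) = v_0v_{-1}(1−ρ)²`
# [Casselman1995 §6.4 p. 63; Keys1984 §3–§4, §7 Thm (2); TateThesis1967 §2.4; Rogawski1990 §12.2 (2)]

Cell hodgecm-mathlib (D-0151), FLOOR 0, Track B «K2-LIT», engine E3, crux item H413 = stmt-HodgeConjecture-24833 (route `HCCMUnconditional`, no route verbs); target BY NAME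
the OPEN leaf `…K2E3EllipticInputs.U4Keys.sig_K2E3KeysThmTwoContractingRamifiedCharOne` (U4Keys ED. 7; cand v5 leaf (U4f-χ₁-ram-one-d0B)), design D-I, plan `DESIGN-B-v1`
(`K2/K2E3-p06/g5/DESIGN-B-v1-BranchBDepthZero.K2E3-p06-g5.md`) steps (B6)–(B7).  Author K2E3-p06 (g5), line lead (D61).  `--supports stmt-HodgeConjecture-24833 --as helper`; THEOREMS ONLY.
NOT THE PAYER: after this file Branch B at depth zero is reduced to the EVALUATION OF THE TWO BASE SHELLS `T_0 = ∫_{m=1} c`, `T_1 = ∫_{m=q_w} c` place by place (inert ∕ ramified) and the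
volumes `v_0 = μ{m ≤ 1}`, `v_{-1} = μ{m < 1}` (steps (B8)–(B11)); `f`-FREE (pure analysis on `N`): the representation theory enters only through the hypothesis `G₁G₂ = v_0v_{-1}` of ★ (B4).

THE MATHEMATICS.  `v` non-split, `ϖ` a uniformiser unit of `R = L ⊗ L⁺_v` (`a = ‖ϖ‖ = q_w⁻¹ < 1`), `μ` Haar on `N = N(L⁺_v)`, height `m`, weight `c(u) = χ₁(σ u₀₂)⁻¹χ₂(−1)‖u₀₂‖⁻¹` (unit `u₀₂`;
else `0`; `χ₁, χ₂` arbitrary; carried as a LETTER `c` with its defining hypothesis `hc`, so that statements stay small), shells `S_j = {m = a^{-j}}` (`j ∈ ℕ`; `S_0 = {m = 1}`), `T_j := ∫_{S_j} c dμ`, `ρ := χ₁(ϖ·σϖ)` with `|ρ| < 1` ASSUMED (true for `|χ₁| = ‖·‖^s`, `s > 0`).  The heights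
lie in `{0} ∪ a^ℤ` (★ `height_le_one_or_eq_inv_pow`), so `{m > 1} = ⊔_{n} S_{n+1}` and `{m ≥ 1} = S_0 ⊔ {m > 1}`; ★ (B5) gives `T_{j+2} = ρT_j`.  Hence, for `c` integrable on the regions:
* (inside §2) `Σ_n T_{n+1}` HAS SUM `G₁ = ∫_{m>1} c` (Mathlib `hasSum_integral_iUnion`; shells ★ `height_le_one_or_eq_inv_pow`).
* §2 **`weightIntegral_far_mul_one_sub_eq`** — **`G₁·(1−ρ) = T_1 + ρ·T_0`** (★ `hasSum_of_succ_succ_eq_mul`: `Σ T_{n+1} = (T_1 + T_2)(1−ρ)⁻¹`, `T_2 = ρT_0`);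
  **`weightIntegral_near_eq`** — `G₂ = T_0 + G₁`, hence **`G₂·(1−ρ) = T_0 + T_1`**.
* §3 **`baseShell_equation_of_det`** — if `G₁·G₂ = v_0·v_{-1}` (★ (B4), the Branch-B determinant identity) then **`(T_1 + ρT_0)·(T_0 + T_1) = v_0·v_{-1}·(1−ρ)²`** — DESIGN-B (B7):
  the ONE equation of Branch B at depth zero; inert: `T_0 = −εq(q−1)v`, `T_1 = εYq(q−1)v` (`ρ = Y²`) gives `(qY+1)(Y+q) = 0` [Keys (c)]; ramified: `T_1 = 0`, `T_0 = ±(q−1)v` gives `(qρ−1)(ρ−q) = 0` [Keys (b),(d)].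
HONEST LABEL: HC_CM is proved only modulo the 7 printed citations (2 remaining named inputs: hLiu418 = stmt-HodgeConjecture-24832, h413 = stmt-HodgeConjecture-24833)
until rung 0 closes; count-neutral — this file does NOT pay the leaf; no printed citation is discharged.

## References
* [Casselman1995] W. Casselman, *Introduction to the theory of admissible representations of `p`-adic reductive groups* (1995), §6.4 p. 63 (shell-by-shell evaluation of `c_w(χ)`).
* [Keys1984] D. Keys, *Principal series representations of special unitary groups over local fields*, Compositio Math. 51 (1984), §3–§4, §7 Thm (2) p. 126.
* [TateThesis1967] J. Tate, *Fourier analysis in number fields and Hecke's zeta-functions*, in Cassels–Fröhlich (1967), §2.4 (integration shell by shell).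
* [Rogawski1990] J. D. Rogawski, *Automorphic Representations of Unitary Groups in Three Variables* (1990), §4.5 p. 45, §12.2 (2) p. 173.
-/

set_option autoImplicit false
-- the mandated namespace has the single-problem summit's repeated segment (`HodgeConjecture.HodgeConjecture`)
set_option linter.dupNamespace false

noncomputable section

open NumberField IsDedekindDomain MeasureTheory
open scoped Matrix MatrixGroups WithZero Valued NNReal ENNReal
open Literature.NumberTheory Literature.NumberTheory.Automorphic Literature.NumberTheory.Automorphic.UnitaryGroup
open Literature.NumberTheory.Rogawski1990 Literature.NumberTheory.GaloisRepresentations Literature.NumberTheory.GaloisRepresentations.IsNonarchimedeanLocalField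

namespace Summit.HodgeConjecture.HodgeConjecture.Cruxes.H413.K2E3WeightShellSeries

open Summit.HodgeConjecture.HodgeConjecture.Cruxes.H413
open Summit.HodgeConjecture.HodgeConjecture.Cruxes.H413.K2E3WeightShellDilation

-- the weight letter `hc` and every statement below carry the `(I, θ)`-cell coercion chains: generous instance budget for the whole module
set_option synthInstance.maxHeartbeats 400000
set_option maxHeartbeats 4000000

open Classical

variable (L : Type) [Field L] [NumberField L] [IsCMField L] (v : HeightOneSpectrum (𝓞 ↥(maximalRealSubfield L)))
  (hns : ∀ w : PlacesOver L v, IsCMField.complexConj L • w.1 = w.1)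
  (χ₁ : (LocalRing L v)ˣ →* ℂˣ) (χ₂ : ↥(normOneUnits (conjLocal L (IsCMField.complexConj L) v)) →* ℂˣ)
  (ϖ : (LocalRing L v)ˣ) (hϖ : ∀ w : PlacesOver L v, Valued.v ((ϖ : LocalRing L v) w) = WithZero.exp (-1 : ℤ))
  [MeasurableSpace ↥(cmBorelTriple L 3 v).N] [BorelSpace ↥(cmBorelTriple L 3 v).N] (μ : Measure ↥(cmBorelTriple L 3 v).N) [μ.IsHaarMeasure]
  (c : ↥(cmBorelTriple L 3 v).N → ℂ)
  (hc : ∀ u : ↥(cmBorelTriple L 3 v).N, c u =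
    if hb : IsUnit (((((u : ↥(unitaryGroupOfForm (conjLocal L (IsCMField.complexConj L) v) (cmLocalForm L 3 v)))) : GL (Fin 3) (LocalRing L v)) : Matrix (Fin 3) (Fin 3) (LocalRing L v)) 0 2) then
      ((((χ₁ (Units.map (conjLocal L (IsCMField.complexConj L) v : LocalRing L v →* LocalRing L v) hb.unit))⁻¹ : ℂˣ) : ℂ) *
        ((χ₂ ⟨-1, F0P3cStCharTSBigCellFactorisation.neg_one_mem_normOneUnits (conjLocal L (IsCMField.complexConj L) v)⟩ : ℂˣ) : ℂ) *
        ((((unitModulusChar (LocalRing L v) hb.unit)⁻¹ : ℝ≥0) : ℝ) : ℂ))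
    else 0)

/-! ## §1 The closed forms: `G₁(1−ρ) = T_1 + ρT_0`, `G₂ = T_0 + G₁` -/

include hns hϖ hc in
set_option maxHeartbeats 10000000 in
/-- **`G₁·(1 − ρ) = T_1 + ρ·T_0`**, `G₁ = ∫_{m>1} c dμ`, `T_j = ∫_{S_j} c dμ`, `ρ = χ₁(ϖ·σϖ)` with `|ρ| < 1`, `μ` Haar: the shell series `n ↦ T_{n+1}` (sum `G₁`) satisfies `T_{n+3} = ρT_{n+1}` (★ (B5)
`setIntegral_weight_shell_succ_succ`), so ★ `hasSum_of_succ_succ_eq_mul` sums it to `(T_1 + T_2)(1−ρ)⁻¹`, and `T_2 = ρT_0` (★ (B5) at `j = 0`).  DESIGN-B (B6).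
[cite: Casselman1995, §6.4 p. 63] [cite: Keys1984, §3–§4] [cite: TateThesis1967, §2.4] -/
theorem weightIntegral_far_mul_one_sub_eq
    (hρ : ‖((χ₁ (ϖ * Units.map (conjLocal L (IsCMField.complexConj L) v : LocalRing L v →* LocalRing L v) ϖ) : ℂˣ) : ℂ)‖ < 1)
    (hint : IntegrableOn c
      {u : ↥(cmBorelTriple L 3 v).N | 1 < (((∏ w' : PlacesOver L v, normAbs (w'.1.adicCompletion L) ((((((u : ↥(unitaryGroupOfForm (conjLocal L (IsCMField.complexConj L) v) (cmLocalForm L 3 v)))) : GL (Fin 3) (LocalRing L v)) : Matrix (Fin 3) (Fin 3) (LocalRing L v)) 0 2) w')) : ℝ≥0) : ℝ)} μ) :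
    (∫ u in {u : ↥(cmBorelTriple L 3 v).N | 1 < (((∏ w' : PlacesOver L v, normAbs (w'.1.adicCompletion L) ((((((u : ↥(unitaryGroupOfForm (conjLocal L (IsCMField.complexConj L) v) (cmLocalForm L 3 v)))) : GL (Fin 3) (LocalRing L v)) : Matrix (Fin 3) (Fin 3) (LocalRing L v)) 0 2) w')) : ℝ≥0) : ℝ)},
        c u ∂μ) * (1 - ((χ₁ (ϖ * Units.map (conjLocal L (IsCMField.complexConj L) v : LocalRing L v →* LocalRing L v) ϖ) : ℂˣ) : ℂ)) =
      (∫ u in {u : ↥(cmBorelTriple L 3 v).N | (((∏ w' : PlacesOver L v, normAbs (w'.1.adicCompletion L) ((((((u : ↥(unitaryGroupOfForm (conjLocal L (IsCMField.complexConj L) v) (cmLocalForm L 3 v)))) : GL (Fin 3) (LocalRing L v)) : Matrix (Fin 3) (Fin 3) (LocalRing L v)) 0 2) w')) : ℝ≥0) : ℝ) = (((unitModulusChar (LocalRing L v) ϖ : ℝ≥0) : ℝ)⁻¹) ^ 1},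
        c u ∂μ) +
      ((χ₁ (ϖ * Units.map (conjLocal L (IsCMField.complexConj L) v : LocalRing L v →* LocalRing L v) ϖ) : ℂˣ) : ℂ) *
      (∫ u in {u : ↥(cmBorelTriple L 3 v).N | (((∏ w' : PlacesOver L v, normAbs (w'.1.adicCompletion L) ((((((u : ↥(unitaryGroupOfForm (conjLocal L (IsCMField.complexConj L) v) (cmLocalForm L 3 v)))) : GL (Fin 3) (LocalRing L v)) : Matrix (Fin 3) (Fin 3) (LocalRing L v)) 0 2) w')) : ℝ≥0) : ℝ) = (((unitModulusChar (LocalRing L v) ϖ : ℝ≥0) : ℝ)⁻¹) ^ 0},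
        c u ∂μ) := by
  set ρ : ℂ := ((χ₁ (ϖ * Units.map (conjLocal L (IsCMField.complexConj L) v : LocalRing L v →* LocalRing L v) ϖ) : ℂˣ) : ℂ) with hρdef
  set T : ℕ → ℂ := fun j => ∫ u in {u : ↥(cmBorelTriple L 3 v).N | (((∏ w' : PlacesOver L v, normAbs (w'.1.adicCompletion L) ((((((u : ↥(unitaryGroupOfForm (conjLocal L (IsCMField.complexConj L) v) (cmLocalForm L 3 v)))) : GL (Fin 3) (LocalRing L v)) : Matrix (Fin 3) (Fin 3) (LocalRing L v)) 0 2) w')) : ℝ≥0) : ℝ) = (((unitModulusChar (LocalRing L v) ϖ : ℝ≥0) : ℝ)⁻¹) ^ j},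
        c u ∂μ with hT
  -- the two-step recursion `T_{j+2} = ρ T_j` (★ (B5))
  have hcfun : c = _ := funext hc
  have hrec : ∀ j : ℕ, T (j + 2) = ρ * T j := fun j => by
    simp only [hT, hcfun]
    exact setIntegral_weight_shell_succ_succ L v μ χ₁ χ₂ ϖ j
  -- the shell series `n ↦ T_{n+1}` and its two sums
  -- the shell series `n ↦ T_{n+1}` HAS SUM `G₁` (shells measurable, disjoint, covering `{m > 1}` ★ `height_le_one_or_eq_inv_pow`; Mathlib `hasSum_integral_iUnion`)
  have ha0 : 0 < ((unitModulusChar (LocalRing L v) ϖ : ℝ≥0) : ℝ) := NNReal.coe_pos.2 distribHaarChar_pos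
  have ha1 : ((unitModulusChar (LocalRing L v) ϖ : ℝ≥0) : ℝ) < 1 := by
    exact_mod_cast K2E3SphericalCFunctionShellExpansion.unitModulusChar_uniformizer_lt_one L v hns ϖ hϖ
  have hq : 1 < (((unitModulusChar (LocalRing L v) ϖ : ℝ≥0) : ℝ)⁻¹) := (one_lt_inv_iff₀.2 ⟨ha0, ha1⟩)
  have hm : Measurable fun u : ↥(cmBorelTriple L 3 v).N => (((∏ w' : PlacesOver L v, normAbs (w'.1.adicCompletion L) ((((((u : ↥(unitaryGroupOfForm (conjLocal L (IsCMField.complexConj L) v) (cmLocalForm L 3 v)))) : GL (Fin 3) (LocalRing L v)) : Matrix (Fin 3) (Fin 3) (LocalRing L v)) 0 2) w')) : ℝ≥0) : ℝ) :=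
    (F0P3cStCharTSKeys3AnnulusDock.continuous_norm_entry L v).measurable
  set S : ℕ → Set ↥(cmBorelTriple L 3 v).N := fun n => {u | (((∏ w' : PlacesOver L v, normAbs (w'.1.adicCompletion L) ((((((u : ↥(unitaryGroupOfForm (conjLocal L (IsCMField.complexConj L) v) (cmLocalForm L 3 v)))) : GL (Fin 3) (LocalRing L v)) : Matrix (Fin 3) (Fin 3) (LocalRing L v)) 0 2) w')) : ℝ≥0) : ℝ) = (((unitModulusChar (LocalRing L v) ϖ : ℝ≥0) : ℝ)⁻¹) ^ (n + 1)} with hS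
  have hSm : ∀ n, MeasurableSet (S n) := fun n => measurableSet_eq_fun hm measurable_const
  have hdisjS : Pairwise (Function.onFun Disjoint S) := fun i j hij => Set.disjoint_left.2 fun u hi hj => hij <| by
    have h : (((unitModulusChar (LocalRing L v) ϖ : ℝ≥0) : ℝ)⁻¹) ^ (i + 1) = (((unitModulusChar (LocalRing L v) ϖ : ℝ≥0) : ℝ)⁻¹) ^ (j + 1) := hi.symm.trans hj
    exact Nat.succ_injective (pow_right_injective₀ (zero_lt_one.trans hq) hq.ne' h)
  have hU : (⋃ n, S n) = {u : ↥(cmBorelTriple L 3 v).N | 1 < (((∏ w' : PlacesOver L v, normAbs (w'.1.adicCompletion L) ((((((u : ↥(unitaryGroupOfForm (conjLocal L (IsCMField.complexConj L) v) (cmLocalForm L 3 v)))) : GL (Fin 3) (LocalRing L v)) : Matrix (Fin 3) (Fin 3) (LocalRing L v)) 0 2) w')) : ℝ≥0) : ℝ)} := by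
    refine Set.ext fun u => ⟨fun hu => ?_, fun hu => ?_⟩
    · obtain ⟨n, hn⟩ := Set.mem_iUnion.1 hu
      simp only [hS, Set.mem_setOf_eq] at hn ⊢
      rw [hn]
      exact one_lt_pow₀ hq (Nat.succ_ne_zero n)
    · rcases K2E3SphericalCFunctionShellExpansion.height_le_one_or_eq_inv_pow L v hns ϖ hϖ u with h | ⟨n, hn⟩
      · exact absurd hu (not_lt.2 h)
      · exact Set.mem_iUnion.2 ⟨n, hn⟩
  have hser : HasSum (fun n : ℕ => T (n + 1)) (∫ u in {u : ↥(cmBorelTriple L 3 v).N | 1 < (((∏ w' : PlacesOver L v, normAbs (w'.1.adicCompletion L) ((((((u : ↥(unitaryGroupOfForm (conjLocal L (IsCMField.complexConj L) v) (cmLocalForm L 3 v)))) : GL (Fin 3) (LocalRing L v)) : Matrix (Fin 3) (Fin 3) (LocalRing L v)) 0 2) w')) : ℝ≥0) : ℝ)}, c u ∂μ) := by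
    have h := hasSum_integral_iUnion (μ := μ) (f := c) hSm hdisjS (by rw [hU]; exact hint)
    rw [hU] at h
    exact h
  have hser' : HasSum (fun n : ℕ => T (n + 1)) ((T (0 + 1) + T (1 + 1)) * (1 - ρ)⁻¹) :=
    K2E3SphericalCFunctionClosedForm.hasSum_of_succ_succ_eq_mul hρ (fun n => by rw [show n + 2 + 1 = (n + 1) + 2 by ring]; exact hrec (n + 1))
  have heq := hser.unique hser'
  have h1ρ : (1 - ρ) ≠ 0 := by
    intro h0
    have h1 : ρ = 1 := by linear_combination -h0
    rw [h1, norm_one] at hρ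
    exact lt_irrefl _ hρ
  change (∫ u in {u : ↥(cmBorelTriple L 3 v).N | 1 < (((∏ w' : PlacesOver L v, normAbs (w'.1.adicCompletion L) ((((((u : ↥(unitaryGroupOfForm (conjLocal L (IsCMField.complexConj L) v) (cmLocalForm L 3 v)))) : GL (Fin 3) (LocalRing L v)) : Matrix (Fin 3) (Fin 3) (LocalRing L v)) 0 2) w')) : ℝ≥0) : ℝ)}, _ ∂μ) * (1 - ρ) = T 1 + ρ * T 0
  rw [heq, zero_add, show (1 : ℕ) + 1 = 0 + 2 from rfl, hrec 0, mul_assoc, inv_mul_cancel₀ h1ρ, mul_one]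

omit [μ.IsHaarMeasure] in
include hns hϖ in
set_option maxHeartbeats 10000000 in
/-- **`G₂ = T_0 + G₁`**: `{m ≥ 1} = S_0 ⊔ {m > 1}` with `S_0 = {m = 1} = {m = ‖ϖ‖^{-0}}` (the heights avoid `(1, ‖ϖ‖⁻¹)`, ★ `height_le_one_or_eq_inv_pow`); Mathlib `setIntegral_union`
for `c` integrable on `{m ≥ 1}`. [cite: Casselman1995, §6.4 p. 63] [cite: TateThesis1967, §2.4] -/
theorem weightIntegral_near_eq
    (hint : IntegrableOn c
      {u : ↥(cmBorelTriple L 3 v).N | 1 ≤ (((∏ w' : PlacesOver L v, normAbs (w'.1.adicCompletion L) ((((((u : ↥(unitaryGroupOfForm (conjLocal L (IsCMField.complexConj L) v) (cmLocalForm L 3 v)))) : GL (Fin 3) (LocalRing L v)) : Matrix (Fin 3) (Fin 3) (LocalRing L v)) 0 2) w')) : ℝ≥0) : ℝ)} μ) :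
    (∫ u in {u : ↥(cmBorelTriple L 3 v).N | 1 ≤ (((∏ w' : PlacesOver L v, normAbs (w'.1.adicCompletion L) ((((((u : ↥(unitaryGroupOfForm (conjLocal L (IsCMField.complexConj L) v) (cmLocalForm L 3 v)))) : GL (Fin 3) (LocalRing L v)) : Matrix (Fin 3) (Fin 3) (LocalRing L v)) 0 2) w')) : ℝ≥0) : ℝ)},
        c u ∂μ) =
      (∫ u in {u : ↥(cmBorelTriple L 3 v).N | (((∏ w' : PlacesOver L v, normAbs (w'.1.adicCompletion L) ((((((u : ↥(unitaryGroupOfForm (conjLocal L (IsCMField.complexConj L) v) (cmLocalForm L 3 v)))) : GL (Fin 3) (LocalRing L v)) : Matrix (Fin 3) (Fin 3) (LocalRing L v)) 0 2) w')) : ℝ≥0) : ℝ) = (((unitModulusChar (LocalRing L v) ϖ : ℝ≥0) : ℝ)⁻¹) ^ 0},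
        c u ∂μ) +
      (∫ u in {u : ↥(cmBorelTriple L 3 v).N | 1 < (((∏ w' : PlacesOver L v, normAbs (w'.1.adicCompletion L) ((((((u : ↥(unitaryGroupOfForm (conjLocal L (IsCMField.complexConj L) v) (cmLocalForm L 3 v)))) : GL (Fin 3) (LocalRing L v)) : Matrix (Fin 3) (Fin 3) (LocalRing L v)) 0 2) w')) : ℝ≥0) : ℝ)},
        c u ∂μ) := by
  have ha0 : 0 < ((unitModulusChar (LocalRing L v) ϖ : ℝ≥0) : ℝ) := NNReal.coe_pos.2 distribHaarChar_pos
  have ha1 : ((unitModulusChar (LocalRing L v) ϖ : ℝ≥0) : ℝ) < 1 := by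
    exact_mod_cast K2E3SphericalCFunctionShellExpansion.unitModulusChar_uniformizer_lt_one L v hns ϖ hϖ
  have hq : 1 < (((unitModulusChar (LocalRing L v) ϖ : ℝ≥0) : ℝ)⁻¹) := (one_lt_inv_iff₀.2 ⟨ha0, ha1⟩)
  have hm : Measurable fun u : ↥(cmBorelTriple L 3 v).N => (((∏ w' : PlacesOver L v, normAbs (w'.1.adicCompletion L) ((((((u : ↥(unitaryGroupOfForm (conjLocal L (IsCMField.complexConj L) v) (cmLocalForm L 3 v)))) : GL (Fin 3) (LocalRing L v)) : Matrix (Fin 3) (Fin 3) (LocalRing L v)) 0 2) w')) : ℝ≥0) : ℝ) :=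
    (F0P3cStCharTSKeys3AnnulusDock.continuous_norm_entry L v).measurable
  have hTm : MeasurableSet {u : ↥(cmBorelTriple L 3 v).N | 1 < (((∏ w' : PlacesOver L v, normAbs (w'.1.adicCompletion L) ((((((u : ↥(unitaryGroupOfForm (conjLocal L (IsCMField.complexConj L) v) (cmLocalForm L 3 v)))) : GL (Fin 3) (LocalRing L v)) : Matrix (Fin 3) (Fin 3) (LocalRing L v)) 0 2) w')) : ℝ≥0) : ℝ)} := measurableSet_lt measurable_const hm
  -- `{m ≥ 1} = S_0 ∪ {m > 1}`
  have hcover : {u : ↥(cmBorelTriple L 3 v).N | 1 ≤ (((∏ w' : PlacesOver L v, normAbs (w'.1.adicCompletion L) ((((((u : ↥(unitaryGroupOfForm (conjLocal L (IsCMField.complexConj L) v) (cmLocalForm L 3 v)))) : GL (Fin 3) (LocalRing L v)) : Matrix (Fin 3) (Fin 3) (LocalRing L v)) 0 2) w')) : ℝ≥0) : ℝ)} =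
      {u : ↥(cmBorelTriple L 3 v).N | (((∏ w' : PlacesOver L v, normAbs (w'.1.adicCompletion L) ((((((u : ↥(unitaryGroupOfForm (conjLocal L (IsCMField.complexConj L) v) (cmLocalForm L 3 v)))) : GL (Fin 3) (LocalRing L v)) : Matrix (Fin 3) (Fin 3) (LocalRing L v)) 0 2) w')) : ℝ≥0) : ℝ) = (((unitModulusChar (LocalRing L v) ϖ : ℝ≥0) : ℝ)⁻¹) ^ 0} ∪
      {u : ↥(cmBorelTriple L 3 v).N | 1 < (((∏ w' : PlacesOver L v, normAbs (w'.1.adicCompletion L) ((((((u : ↥(unitaryGroupOfForm (conjLocal L (IsCMField.complexConj L) v) (cmLocalForm L 3 v)))) : GL (Fin 3) (LocalRing L v)) : Matrix (Fin 3) (Fin 3) (LocalRing L v)) 0 2) w')) : ℝ≥0) : ℝ)} := by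
    refine Set.ext fun u => ?_
    rw [Set.mem_union, Set.mem_setOf_eq, Set.mem_setOf_eq, Set.mem_setOf_eq, pow_zero]
    constructor
    · intro h
      rcases h.lt_or_eq with h' | h'
      · exact Or.inr h'
      · exact Or.inl h'.symm
    · rintro (h | h)
      · exact le_of_eq h.symm
      · exact le_of_lt h
  have hdisj : Disjoint {u : ↥(cmBorelTriple L 3 v).N | (((∏ w' : PlacesOver L v, normAbs (w'.1.adicCompletion L) ((((((u : ↥(unitaryGroupOfForm (conjLocal L (IsCMField.complexConj L) v) (cmLocalForm L 3 v)))) : GL (Fin 3) (LocalRing L v)) : Matrix (Fin 3) (Fin 3) (LocalRing L v)) 0 2) w')) : ℝ≥0) : ℝ) = (((unitModulusChar (LocalRing L v) ϖ : ℝ≥0) : ℝ)⁻¹) ^ 0}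
      {u : ↥(cmBorelTriple L 3 v).N | 1 < (((∏ w' : PlacesOver L v, normAbs (w'.1.adicCompletion L) ((((((u : ↥(unitaryGroupOfForm (conjLocal L (IsCMField.complexConj L) v) (cmLocalForm L 3 v)))) : GL (Fin 3) (LocalRing L v)) : Matrix (Fin 3) (Fin 3) (LocalRing L v)) 0 2) w')) : ℝ≥0) : ℝ)} :=
    Set.disjoint_left.2 fun u hu hu' => by
      rw [Set.mem_setOf_eq, pow_zero] at hu; rw [Set.mem_setOf_eq, hu] at hu'; exact lt_irrefl _ hu'
  rw [hcover] at hint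
  rw [hcover, setIntegral_union hdisj hTm (hint.mono_set Set.subset_union_left) (hint.mono_set Set.subset_union_right)]

/-! ## §2 The base-shell equation of Branch B -/

include hns hϖ hc in
set_option maxHeartbeats 10000000 in
/-- **THE BASE-SHELL EQUATION (DESIGN-B (B7)).**  `v` non-split, `ϖ` a uniformiser unit, `μ` Haar on `N(L⁺_v)`, `c` the weight of `(χ₁, χ₂)`, `ρ = χ₁(ϖσϖ)` with `|ρ| < 1`, `T_j = ∫_{S_j} c`,
`v_0 = μ{m ≤ 1}`, `v_{-1} = μ{m < 1}`, and `c` integrable on `{m ≥ 1}`.  IF the Branch-B determinant identity `(∫_{m>1} c)·(∫_{m≥1} c) = v_0·v_{-1}` holds (★ (B4), from an `(I,θ)`-type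
vector killed by `Λ_1`, `Λ_{w₀⁻¹}`), THEN **`(T_1 + ρ·T_0)·(T_0 + T_1) = v_0·v_{-1}·(1 − ρ)²`** — by §1 (`G₁(1−ρ) = T_1 + ρT_0`, `G₂(1−ρ) = (T_0 + G₁)(1−ρ) = T_0 + T_1`).  The reducibility
points of Keys' Theorem (2) at depth zero are the solutions of this quadratic after the base shells are evaluated place by place. [cite: Keys1984, §7 Thm (2) p. 126, §3–§4] [cite: Casselman1995, §6.4, Thm. 6.6.2] [cite: Rogawski1990, §12.2 (2) p. 173] -/
theorem baseShell_equation_of_det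
    (hρ : ‖((χ₁ (ϖ * Units.map (conjLocal L (IsCMField.complexConj L) v : LocalRing L v →* LocalRing L v) ϖ) : ℂˣ) : ℂ)‖ < 1)
    (hint : IntegrableOn c
      {u : ↥(cmBorelTriple L 3 v).N | 1 ≤ (((∏ w' : PlacesOver L v, normAbs (w'.1.adicCompletion L) ((((((u : ↥(unitaryGroupOfForm (conjLocal L (IsCMField.complexConj L) v) (cmLocalForm L 3 v)))) : GL (Fin 3) (LocalRing L v)) : Matrix (Fin 3) (Fin 3) (LocalRing L v)) 0 2) w')) : ℝ≥0) : ℝ)} μ)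
    (hdet : (∫ u in {u : ↥(cmBorelTriple L 3 v).N | 1 < (((∏ w' : PlacesOver L v, normAbs (w'.1.adicCompletion L) ((((((u : ↥(unitaryGroupOfForm (conjLocal L (IsCMField.complexConj L) v) (cmLocalForm L 3 v)))) : GL (Fin 3) (LocalRing L v)) : Matrix (Fin 3) (Fin 3) (LocalRing L v)) 0 2) w')) : ℝ≥0) : ℝ)},
        c u ∂μ) *
      (∫ u in {u : ↥(cmBorelTriple L 3 v).N | 1 ≤ (((∏ w' : PlacesOver L v, normAbs (w'.1.adicCompletion L) ((((((u : ↥(unitaryGroupOfForm (conjLocal L (IsCMField.complexConj L) v) (cmLocalForm L 3 v)))) : GL (Fin 3) (LocalRing L v)) : Matrix (Fin 3) (Fin 3) (LocalRing L v)) 0 2) w')) : ℝ≥0) : ℝ)},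
        c u ∂μ) =
      (μ.real {u : ↥(cmBorelTriple L 3 v).N | (((∏ w' : PlacesOver L v, normAbs (w'.1.adicCompletion L) ((((((u : ↥(unitaryGroupOfForm (conjLocal L (IsCMField.complexConj L) v) (cmLocalForm L 3 v)))) : GL (Fin 3) (LocalRing L v)) : Matrix (Fin 3) (Fin 3) (LocalRing L v)) 0 2) w')) : ℝ≥0) : ℝ) ≤ 1} : ℂ) *
        (μ.real {u : ↥(cmBorelTriple L 3 v).N | (((∏ w' : PlacesOver L v, normAbs (w'.1.adicCompletion L) ((((((u : ↥(unitaryGroupOfForm (conjLocal L (IsCMField.complexConj L) v) (cmLocalForm L 3 v)))) : GL (Fin 3) (LocalRing L v)) : Matrix (Fin 3) (Fin 3) (LocalRing L v)) 0 2) w')) : ℝ≥0) : ℝ) < 1} : ℂ)) :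
    ((∫ u in {u : ↥(cmBorelTriple L 3 v).N | (((∏ w' : PlacesOver L v, normAbs (w'.1.adicCompletion L) ((((((u : ↥(unitaryGroupOfForm (conjLocal L (IsCMField.complexConj L) v) (cmLocalForm L 3 v)))) : GL (Fin 3) (LocalRing L v)) : Matrix (Fin 3) (Fin 3) (LocalRing L v)) 0 2) w')) : ℝ≥0) : ℝ) = (((unitModulusChar (LocalRing L v) ϖ : ℝ≥0) : ℝ)⁻¹) ^ 1},
        c u ∂μ) +
      ((χ₁ (ϖ * Units.map (conjLocal L (IsCMField.complexConj L) v : LocalRing L v →* LocalRing L v) ϖ) : ℂˣ) : ℂ) *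
      (∫ u in {u : ↥(cmBorelTriple L 3 v).N | (((∏ w' : PlacesOver L v, normAbs (w'.1.adicCompletion L) ((((((u : ↥(unitaryGroupOfForm (conjLocal L (IsCMField.complexConj L) v) (cmLocalForm L 3 v)))) : GL (Fin 3) (LocalRing L v)) : Matrix (Fin 3) (Fin 3) (LocalRing L v)) 0 2) w')) : ℝ≥0) : ℝ) = (((unitModulusChar (LocalRing L v) ϖ : ℝ≥0) : ℝ)⁻¹) ^ 0},
        c u ∂μ)) *
    ((∫ u in {u : ↥(cmBorelTriple L 3 v).N | (((∏ w' : PlacesOver L v, normAbs (w'.1.adicCompletion L) ((((((u : ↥(unitaryGroupOfForm (conjLocal L (IsCMField.complexConj L) v) (cmLocalForm L 3 v)))) : GL (Fin 3) (LocalRing L v)) : Matrix (Fin 3) (Fin 3) (LocalRing L v)) 0 2) w')) : ℝ≥0) : ℝ) = (((unitModulusChar (LocalRing L v) ϖ : ℝ≥0) : ℝ)⁻¹) ^ 0},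
        c u ∂μ) +
     (∫ u in {u : ↥(cmBorelTriple L 3 v).N | (((∏ w' : PlacesOver L v, normAbs (w'.1.adicCompletion L) ((((((u : ↥(unitaryGroupOfForm (conjLocal L (IsCMField.complexConj L) v) (cmLocalForm L 3 v)))) : GL (Fin 3) (LocalRing L v)) : Matrix (Fin 3) (Fin 3) (LocalRing L v)) 0 2) w')) : ℝ≥0) : ℝ) = (((unitModulusChar (LocalRing L v) ϖ : ℝ≥0) : ℝ)⁻¹) ^ 1},
        c u ∂μ)) =
      (μ.real {u : ↥(cmBorelTriple L 3 v).N | (((∏ w' : PlacesOver L v, normAbs (w'.1.adicCompletion L) ((((((u : ↥(unitaryGroupOfForm (conjLocal L (IsCMField.complexConj L) v) (cmLocalForm L 3 v)))) : GL (Fin 3) (LocalRing L v)) : Matrix (Fin 3) (Fin 3) (LocalRing L v)) 0 2) w')) : ℝ≥0) : ℝ) ≤ 1} : ℂ) *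
        (μ.real {u : ↥(cmBorelTriple L 3 v).N | (((∏ w' : PlacesOver L v, normAbs (w'.1.adicCompletion L) ((((((u : ↥(unitaryGroupOfForm (conjLocal L (IsCMField.complexConj L) v) (cmLocalForm L 3 v)))) : GL (Fin 3) (LocalRing L v)) : Matrix (Fin 3) (Fin 3) (LocalRing L v)) 0 2) w')) : ℝ≥0) : ℝ) < 1} : ℂ) *
      (1 - ((χ₁ (ϖ * Units.map (conjLocal L (IsCMField.complexConj L) v : LocalRing L v →* LocalRing L v) ϖ) : ℂˣ) : ℂ)) ^ 2 := by
  have hfar := weightIntegral_far_mul_one_sub_eq L v hns χ₁ χ₂ ϖ hϖ μ c hc hρ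
    (hint.mono_set (fun u hu => by rw [Set.mem_setOf_eq] at hu ⊢; exact le_of_lt hu))
  have hnear := weightIntegral_near_eq L v hns ϖ hϖ μ c hint
  rw [hnear] at hdet
  -- `G₁(1−ρ) = T₁ + ρT₀`; `(T₀ + G₁)(1−ρ) = T₀ + T₁` after `T₀(1−ρ) + (T₁ + ρT₀)`
  linear_combination (1 - ((χ₁ (ϖ * Units.map (conjLocal L (IsCMField.complexConj L) v : LocalRing L v →* LocalRing L v) ϖ) : ℂˣ) : ℂ)) ^ 2 * hdet -
    ((∫ u in {u : ↥(cmBorelTriple L 3 v).N | (((∏ w' : PlacesOver L v, normAbs (w'.1.adicCompletion L) ((((((u : ↥(unitaryGroupOfForm (conjLocal L (IsCMField.complexConj L) v) (cmLocalForm L 3 v)))) : GL (Fin 3) (LocalRing L v)) : Matrix (Fin 3) (Fin 3) (LocalRing L v)) 0 2) w')) : ℝ≥0) : ℝ) = (((unitModulusChar (LocalRing L v) ϖ : ℝ≥0) : ℝ)⁻¹) ^ 0},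
        c u ∂μ) * (1 - ((χ₁ (ϖ * Units.map (conjLocal L (IsCMField.complexConj L) v : LocalRing L v →* LocalRing L v) ϖ) : ℂˣ) : ℂ)) +
      ((∫ u in {u : ↥(cmBorelTriple L 3 v).N | (((∏ w' : PlacesOver L v, normAbs (w'.1.adicCompletion L) ((((((u : ↥(unitaryGroupOfForm (conjLocal L (IsCMField.complexConj L) v) (cmLocalForm L 3 v)))) : GL (Fin 3) (LocalRing L v)) : Matrix (Fin 3) (Fin 3) (LocalRing L v)) 0 2) w')) : ℝ≥0) : ℝ) = (((unitModulusChar (LocalRing L v) ϖ : ℝ≥0) : ℝ)⁻¹) ^ 1},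
        c u ∂μ) +
      ((χ₁ (ϖ * Units.map (conjLocal L (IsCMField.complexConj L) v : LocalRing L v →* LocalRing L v) ϖ) : ℂˣ) : ℂ) *
      (∫ u in {u : ↥(cmBorelTriple L 3 v).N | (((∏ w' : PlacesOver L v, normAbs (w'.1.adicCompletion L) ((((((u : ↥(unitaryGroupOfForm (conjLocal L (IsCMField.complexConj L) v) (cmLocalForm L 3 v)))) : GL (Fin 3) (LocalRing L v)) : Matrix (Fin 3) (Fin 3) (LocalRing L v)) 0 2) w')) : ℝ≥0) : ℝ) = (((unitModulusChar (LocalRing L v) ϖ : ℝ≥0) : ℝ)⁻¹) ^ 0},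
        c u ∂μ)) +
      (∫ u in {u : ↥(cmBorelTriple L 3 v).N | 1 < (((∏ w' : PlacesOver L v, normAbs (w'.1.adicCompletion L) ((((((u : ↥(unitaryGroupOfForm (conjLocal L (IsCMField.complexConj L) v) (cmLocalForm L 3 v)))) : GL (Fin 3) (LocalRing L v)) : Matrix (Fin 3) (Fin 3) (LocalRing L v)) 0 2) w')) : ℝ≥0) : ℝ)},
        c u ∂μ) * (1 - ((χ₁ (ϖ * Units.map (conjLocal L (IsCMField.complexConj L) v : LocalRing L v →* LocalRing L v) ϖ) : ℂˣ) : ℂ))) * hfar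

end Summit.HodgeConjecture.HodgeConjecture.Cruxes.H413.K2E3WeightShellSeries

end
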